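import Literature.AlgebraicGeometry.GaoUllmo2025.Theorem31
import Mathlib.LinearAlgebra.Basis.VectorSpace
import HarnessLib

/-!
# Gao–Ullmo 2025, Theorem 3.1 (Pohlmann), "In particular" clause: `dim_ℚ B^p(A) = #{P : |P| = 2p, (3.2)}`

Z. Gao, E. Ullmo, *Hodge cycles and quadratic relations between holomorphic periods on CM abelian varieties*,
J. Inst. Math. Jussieu **25** (2025) 215–249 = arXiv:2411.12249 [GaoUllmo2025], Theorem 3.1, last sentence (art.
p. 11, chunk p0012 L8 of the held published text `corpus:paper:galaxy-pdf-4667137180`; arXiv chunk p0009 L39),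
VERBATIM: "In particular `dim_ℚ B^p(A)` is the number of ordered `P ∈ 𝒫(S)` with `|P| = 2p` satisfying (3.2)."

KERNEL-PROVED here (`theorem31_finrank`, and `finrank_Bp_eq_card` without the ordering convention) from
`Theorem31.span_Bp_eq_span_wedge`: the classes of `H^{2p}(A, ℚ)` have RATIONAL coordinates in the wedge basis `W`
built from the rational basis `(b_m)` of `ℂ^S` (`ratBasis`, `exists_rat_repr_of_mem_ratStr`), so a `ℚ`-basis of
`B^p(A)` stays `ℂ`-linearly independent (`linearIndependent_complex_basis_Bp`, via a Hamel basis of `ℂ/ℚ`,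
`linearIndependent_cast_of_rat`), whence `dim_ℚ B^p = dim_ℂ (B^p ⊗ ℂ)` (`finrank_span_Bp`) `= #{P : (3.2)}` (the
`[P]` being linearly independent).

## References

* [GaoUllmo2025] Z. Gao, E. Ullmo, J. Inst. Math. Jussieu 25 (2025) 215–249 — Theorem 3.1, "In particular" clause,
  §3.1, art. p. 11.

## Provenance

Staged by the pub-hodgecm formalisation cell (lineage `pub-hodgecm-pohl`) under the LEAN-IN-TREE rule; supersedes
§Finrank of the standalone package's `HodgeCM/Literature/GaoUllmoTheorem31.lean` (gate run 21) and the named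
proposition `HodgeCM.GaoUllmo.Theorem31_finrank` of `HodgeCM/Literature/GaoUllmo.lean` (gate run 24), stated here
DIRECTLY as the theorem `theorem31_finrank` (same binders and conclusion; D-0026), namespace `HodgeCM.GaoUllmo` ↦
`Literature.AlgebraicGeometry.GaoUllmo2025`.
-/

noncomputable section

open Module

attribute [local instance] Classical.propDecidable

namespace Literature.AlgebraicGeometry.GaoUllmo2025

section Finrank

/-- Rational vectors that are `ℚ`-linearly independent are `ℂ`-linearly independent (via a Hamel basis of `ℂ/ℚ`).
[folklore] -/
theorem linearIndependent_cast_of_rat {ι N : Type} {y : ι → N → ℚ} (hy : LinearIndependent ℚ y) :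
    LinearIndependent ℂ (fun i k => algebraMap ℚ ℂ (y i k)) := by
  rw [linearIndependent_iff'] at hy ⊢
  intro s c hc i hi
  let γ := Basis.ofVectorSpace ℚ ℂ
  suffices h : ∀ l, γ.repr (c i) l = 0 by
    have : γ.repr (c i) = 0 := Finsupp.ext h
    simpa using this
  intro l
  have key : ∀ k, ∑ j ∈ s, γ.repr (c j) l * y j k = 0 := by
    intro k
    have hk := congr_fun hc k
    simp only [Finset.sum_apply, Pi.smul_apply, smul_eq_mul, Pi.zero_apply] at hk
    have hk' : γ.repr (∑ j ∈ s, c j * algebraMap ℚ ℂ (y j k)) l = 0 := by rw [hk]; simp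
    rw [map_sum, Finsupp.coe_finsetSum, Finset.sum_apply] at hk'
    rw [← hk']
    refine Finset.sum_congr rfl fun j _ => ?_
    have : c j * algebraMap ℚ ℂ (y j k) = (y j k) • c j := by
      rw [mul_comm, Algebra.smul_def]
    rw [this, map_smul, Finsupp.smul_apply, smul_eq_mul, mul_comm]
  have := hy s (fun j => γ.repr (c j) l) (by
    funext k
    simp only [Finset.sum_apply, Pi.smul_apply, smul_eq_mul, Pi.zero_apply]
    exact key k) i hi
  exact this

variable {E : Type} [CommRing E] [Algebra ℚ E] [Module.Finite ℚ E]

/-- The rational vectors `b_m ∈ ℂ^S` are `ℂ`-linearly independent (columns of the invertible matrix `A`).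
[folklore] -/
theorem linearIndependent_ratVec_bE (hE : IsCMAlgebra E) : LinearIndependent ℂ (fun m => ratVec E (bE E m)) := by
  have h1 : LinearIndependent ℂ (AC hE).col := Matrix.linearIndependent_cols_iff_isUnit.mpr (isUnit_AC hE)
  let Φ : (Fin (finrank ℚ E) → ℂ) ≃ₗ[ℂ] (Emb E → ℂ) := LinearEquiv.funCongrLeft ℂ ℂ (embEquivFin hE)
  have h2 := h1.map' Φ.toLinearMap Φ.ker
  have h3 : (⇑Φ.toLinearMap ∘ (AC hE).col) = fun m => ratVec E (bE E m) := by
    funext m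
    funext φ
    simp [Φ, LinearEquiv.funCongrLeft_apply, LinearMap.funLeft_apply, AC, Matrix.col_apply]
  rw [h3] at h2
  exact h2

/-- The `ℂ`-basis `(b_m)_m` of `ℂ^S` consisting of RATIONAL vectors. [folklore] -/
def ratBasis (hE : IsCMAlgebra E) : Basis (Fin (finrank ℚ E)) ℂ (VC E) :=
  basisOfLinearIndependentOfCardEqFinrank' _ (linearIndependent_ratVec_bE hE)
    (by rw [Fintype.card_fin, Module.finrank_pi, card_emb_eq_finrank hE])

/-- `ratBasis hE m = b_m`. [folklore] -/
@[simp] theorem ratBasis_apply (hE : IsCMAlgebra E) (m : Fin (finrank ℚ E)) :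
    ratBasis hE m = ratVec E (bE E m) := by
  simp [ratBasis]

/-- Rational vectors have rational `ratBasis`-coordinates. [folklore] -/
theorem repr_ratBasis_ratVec (hE : IsCMAlgebra E) (a : E) (m : Fin (finrank ℚ E)) :
    (ratBasis hE).repr (ratVec E a) m = algebraMap ℚ ℂ ((bE E).repr a m) := by
  have : ratVec E a = ∑ m, (algebraMap ℚ ℂ ((bE E).repr a m)) • ratBasis hE m := by
    conv_lhs => rw [← (bE E).sum_repr a]
    rw [map_sum]
    refine Finset.sum_congr rfl fun m _ => ?_
    rw [map_smul, ratBasis_apply, algebraMap_smul]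
  rw [this, (ratBasis hE).repr_sum_self]

/-- The basis `W = (b_{g₁} ∧ ⋯ ∧ b_{g_r})_g` of `⋀^r ℂ^S` made of rational wedges. [folklore] -/
abbrev ratWedgeBasis (hE : IsCMAlgebra E) (r : ℕ) :
    Basis (Set.powersetCard (Fin (finrank ℚ E)) r) ℂ (Hr E r) :=
  (ratBasis hE).exteriorPower r

/-- Rational classes have RATIONAL coordinates in the basis `W`. [folklore] -/
theorem exists_rat_repr_of_mem_ratStr (hE : IsCMAlgebra E) (r : ℕ) {x : Hr E r} (hx : x ∈ ratStr E r)
    (g : Set.powersetCard (Fin (finrank ℚ E)) r) :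
    ∃ q : ℚ, (ratWedgeBasis hE r).repr x g = algebraMap ℚ ℂ q := by
  induction hx using Submodule.span_induction generalizing g with
  | mem x hx =>
    obtain ⟨a, rfl⟩ := hx
    refine ⟨(Matrix.of fun i j => (bE E).repr (a i) (Set.powersetCard.ofFinEmbEquiv.symm g j)).det, ?_⟩
    rw [← Basis.coord_apply, exteriorPower.basis_coord, exteriorPower.ιMultiDual_apply_ιMulti, RingHom.map_det]
    congr 1
    ext i j
    simp only [Matrix.of_apply, RingHom.mapMatrix_apply, Matrix.map_apply, Basis.coord_apply, repr_ratBasis_ratVec]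
  | zero => exact ⟨0, by simp⟩
  | add x y _ _ hx hy =>
    obtain ⟨q₁, h₁⟩ := hx g
    obtain ⟨q₂, h₂⟩ := hy g
    exact ⟨q₁ + q₂, by simp [h₁, h₂]⟩
  | smul q x _ hx =>
    obtain ⟨q₁, h₁⟩ := hx g
    refine ⟨q * q₁, ?_⟩
    have : (q • x : Hr E r) = (algebraMap ℚ ℂ q) • x := (algebraMap_smul ℂ q x).symm
    rw [this, map_smul, Finsupp.smul_apply, h₁, smul_eq_mul, map_mul]

/-- `H^r(A, ℚ)` is contained in the `ℚ`-span of `W`; in particular `B^p(A)` is finite-dimensional over `ℚ`.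
[folklore] -/
theorem ratStr_le_span_ratWedge (hE : IsCMAlgebra E) (r : ℕ) :
    ratStr E r ≤ Submodule.span ℚ (Set.range (ratWedgeBasis hE r)) := by
  intro x hx
  rw [← (ratWedgeBasis hE r).sum_repr x]
  refine Submodule.sum_mem _ fun g _ => ?_
  obtain ⟨q, hq⟩ := exists_rat_repr_of_mem_ratStr hE r hx g
  rw [hq, algebraMap_smul]
  exact Submodule.smul_mem _ q (Submodule.subset_span ⟨g, rfl⟩)

/-- The `W`-coordinate map `H^r → (𝒫_r → ℂ)` (a `ℂ`-linear injection). [folklore] -/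
def coordMap (hE : IsCMAlgebra E) (r : ℕ) : Hr E r →ₗ[ℂ] (Set.powersetCard (Fin (finrank ℚ E)) r → ℂ) :=
  Finsupp.lcoeFun ∘ₗ (ratWedgeBasis hE r).repr.toLinearMap

/-- `coordMap` is the coordinate function. [folklore] -/
@[simp] theorem coordMap_apply (hE : IsCMAlgebra E) (r : ℕ) (x : Hr E r)
    (g : Set.powersetCard (Fin (finrank ℚ E)) r) :
    coordMap hE r x g = (ratWedgeBasis hE r).repr x g := rfl

/-- `coordMap` is injective. [folklore] -/
theorem coordMap_injective (hE : IsCMAlgebra E) (r : ℕ) : Function.Injective (coordMap hE r) := by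
  intro x y h
  apply (ratWedgeBasis hE r).repr.injective
  ext g
  exact congr_fun h g

/-- A `ℚ`-linearly independent family of RATIONAL classes is `ℂ`-linearly independent. [folklore] -/
theorem linearIndependent_complex_of_rat_family (hE : IsCMAlgebra E) (r : ℕ) {ι : Type} (v : ι → Hr E r)
    (hv : ∀ i, v i ∈ ratStr E r) (hli : LinearIndependent ℚ v) : LinearIndependent ℂ v := by
  have hrat : ∀ i g, ∃ q : ℚ, (ratWedgeBasis hE r).repr (v i) g = algebraMap ℚ ℂ q :=
    fun i g => exists_rat_repr_of_mem_ratStr hE r (hv i) g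
  choose y hy using hrat
  have hyQ : LinearIndependent ℚ y := by
    rw [linearIndependent_iff'] at hli ⊢
    intro s d hd i hi
    refine hli s d ?_ i hi
    apply coordMap_injective hE r
    rw [map_sum, map_zero]
    funext g
    rw [Finset.sum_apply, Pi.zero_apply]
    have hdg := congr_fun hd g
    simp only [Finset.sum_apply, Pi.smul_apply, smul_eq_mul, Pi.zero_apply] at hdg
    calc ∑ j ∈ s, coordMap hE r (d j • v j) g
        = ∑ j ∈ s, algebraMap ℚ ℂ (d j * y j g) := by
          refine Finset.sum_congr rfl fun j _ => ?_
          rw [LinearMap.map_smul_of_tower, Pi.smul_apply, coordMap_apply, hy, Algebra.smul_def, map_mul]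
      _ = algebraMap ℚ ℂ (∑ j ∈ s, d j * y j g) := by rw [map_sum]
      _ = 0 := by rw [hdg, map_zero]
  have hcast := linearIndependent_cast_of_rat hyQ
  apply LinearIndependent.of_comp (coordMap hE r)
  have h3 : (⇑(coordMap hE r) ∘ v) = fun i g => algebraMap ℚ ℂ (y i g) := by
    funext i
    funext g
    exact hy i g
  rw [h3]
  exact hcast

variable [LinearOrder (Emb E)]

/-- `B^p(A)` is finite-dimensional over `ℚ`. [folklore] -/
theorem finiteDimensional_Bp (hE : IsCMAlgebra E) (Φ : CMTypeOn E) (p : ℕ) : FiniteDimensional ℚ (Bp Φ p) := by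
  haveI : FiniteDimensional ℚ (Submodule.span ℚ (Set.range (ratWedgeBasis hE (2 * p)))) :=
    FiniteDimensional.span_of_finite ℚ (Set.finite_range _)
  exact Submodule.finiteDimensional_of_le ((inf_le_left).trans (ratStr_le_span_ratWedge hE (2 * p)))

/-- The `ℂ`-span of `B^p` is the `ℂ`-span of any `ℚ`-basis of `B^p`. [folklore] -/
theorem span_Bp_eq_span_basis (Φ : CMTypeOn E) (p : ℕ) {ι : Type} [Fintype ι] (β : Module.Basis ι ℚ (Bp Φ p)) :
    Submodule.span ℂ (Bp Φ p : Set (Hr E (2 * p))) =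
      Submodule.span ℂ (Set.range fun i => ((β i : Bp Φ p) : Hr E (2 * p))) := by
  apply le_antisymm
  · rw [Submodule.span_le]
    intro x hx
    have h := congrArg (fun z : Bp Φ p => (z : Hr E (2 * p))) (β.sum_repr ⟨x, hx⟩)
    simp only [Submodule.coe_sum, Submodule.coe_smul_of_tower] at h
    have hmem : ∑ i, β.repr ⟨x, hx⟩ i • ((β i : Bp Φ p) : Hr E (2 * p)) ∈
        Submodule.span ℂ (Set.range fun i => ((β i : Bp Φ p) : Hr E (2 * p))) :=
      Submodule.sum_mem _ fun i _ => Submodule.smul_of_tower_mem _ _ (Submodule.subset_span ⟨i, rfl⟩)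
    rw [h] at hmem
    exact hmem
  · apply Submodule.span_mono
    rintro _ ⟨i, rfl⟩
    exact (β i).2

/-- A `ℚ`-basis of `B^p` is `ℂ`-linearly independent.  (Implementation note: only semiring-level
linear-independence lemmas are used on `↥(Bp Φ p)`, to keep instance unification cheap.) [folklore] -/
theorem linearIndependent_complex_basis_Bp (hE : IsCMAlgebra E) (Φ : CMTypeOn E) (p : ℕ) {ι : Type}
    (β : Module.Basis ι ℚ (Bp Φ p)) : LinearIndependent ℂ (fun i => ((β i : Bp Φ p) : Hr E (2 * p))) := by
  have hli : LinearIndependent ℚ (fun i => ((β i : Bp Φ p) : Hr E (2 * p))) :=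
    β.linearIndependent.map_injOn (Bp Φ p).subtype (Bp Φ p).injective_subtype.injOn
  have hv : ∀ i, ((β i : Bp Φ p) : Hr E (2 * p)) ∈ ratStr E (2 * p) :=
    fun i => (Submodule.mem_inf.mp (β i).2).1
  exact linearIndependent_complex_of_rat_family hE (2 * p) (fun i => ((β i : Bp Φ p) : Hr E (2 * p))) hv hli

/-- `dim_ℂ (B^p ⊗ ℂ) = dim_ℚ B^p` (inside `H^{2p}(A, ℂ)`). [folklore] -/
theorem finrank_span_Bp (hE : IsCMAlgebra E) (Φ : CMTypeOn E) (p : ℕ) :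
    finrank ℂ (Submodule.span ℂ (Bp Φ p : Set (Hr E (2 * p)))) = finrank ℚ (Bp Φ p) := by
  haveI := finiteDimensional_Bp hE Φ p
  haveI : Module.Free ℚ (Bp Φ p) := Module.Free.of_divisionRing ℚ (Bp Φ p)
  rw [span_Bp_eq_span_basis Φ p (Module.finBasis ℚ (Bp Φ p)),
    finrank_span_eq_card (linearIndependent_complex_basis_Bp hE Φ p (Module.finBasis ℚ (Bp Φ p))),
    Fintype.card_fin]

/-- **`dim_ℚ B^p(A) = #{P ⊂ S : |P| = 2p, (3.2)}` without the ordering convention** (kernel-proved, from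
`span_Bp_eq_span_wedge`). [cite: GaoUllmo2025, Thm 3.1 ("In particular")] -/
theorem finrank_Bp_eq_card (hE : IsCMAlgebra E) (Φ : CMTypeOn E) (p : ℕ) :
    finrank ℚ (Bp Φ p) =
      Nat.card {P : Set.powersetCard (Emb E) (2 * p) // SatisfiesEq32 Φ (P : Finset (Emb E))} := by
  have hY : Submodule.span ℂ (Bp Φ p : Set (Hr E (2 * p))) =
      Submodule.span ℂ (Set.range fun P : {P : Set.powersetCard (Emb E) (2 * p) //
        SatisfiesEq32 Φ (P : Finset (Emb E))} => wedge E (2 * p) P.1) := by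
    rw [span_Bp_eq_span_wedge hE Φ p]
    congr 1
    ext x
    constructor
    · rintro ⟨P, hP, rfl⟩; exact ⟨⟨P, hP⟩, rfl⟩
    · rintro ⟨⟨P, hP⟩, rfl⟩; exact ⟨P, hP, rfl⟩
  have hliA : LinearIndependent ℂ (fun P : {P : Set.powersetCard (Emb E) (2 * p) //
      SatisfiesEq32 Φ (P : Finset (Emb E))} => wedge E (2 * p) P.1) :=
    (linearIndependent_wedge (2 * p)).comp _ Subtype.val_injective
  rw [← finrank_span_Bp hE Φ p, hY, finrank_span_eq_card hliA, Nat.card_eq_fintype_card]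

end Finrank

/-- **Gao–Ullmo Theorem 3.1 (Pohlmann), "In particular" clause** (art. p. 11, chunk p0012 L8; arXiv chunk p0009
L39), VERBATIM: "In particular `dim_ℚ B^p(A)` is the number of ordered `P ∈ 𝒫(S)` with `|P| = 2p` satisfying
(3.2)."  Same hypotheses as `theorem31` (CM algebra `E`, CM type `Φ`, ordering convention, any `p`); the count is
`Nat.card` of the `P ∈ 𝒫_{2p}(S)` satisfying (3.2).  KERNEL-PROVED (`finrank_Bp_eq_card`); the binders and conclusion
are those of the standalone package's named proposition `HodgeCM.GaoUllmo.Theorem31_finrank`.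
[cite: GaoUllmo2025, Thm 3.1 ("In particular")] -/
theorem theorem31_finrank :
    ∀ (E : Type) [CommRing E] [Algebra ℚ E] [Module.Finite ℚ E] [LinearOrder (Emb E)], IsCMAlgebra E →
      ∀ (Φ : CMTypeOn E), OrderConvention Φ → ∀ p : ℕ,
        Module.finrank ℚ (Bp Φ p) =
          Nat.card {P : Set.powersetCard (Emb E) (2 * p) // SatisfiesEq32 Φ (P : Finset (Emb E))} :=
  fun _E _ _ _ _ hE Φ _ p => finrank_Bp_eq_card hE Φ p

end Literature.AlgebraicGeometry.GaoUllmo2025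

end
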